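import Summits.BirchSwinnertonDyer.Rank1Residual.Ordinary.DepthLawReciprocitySkeleton
import Summits.BirchSwinnertonDyer.Rank1Residual.Ordinary.LocalClassOrders
import Summits.BirchSwinnertonDyer.Rank1Residual.Ordinary.LocalDivExponentPointOrder
import HarnessLib

/-!
# C-16's clause at a level `(ℓ, k)` ON ITS OWN LETTER, from the cohomological core of its derivation taken as
# ONE hypothesis about the letter's own points (theorems only; no definition, no named fact, nothing asserted
# about any curve; C-16 stays a CONJECTURE)

HONEST FRAMING (cell `b2b-bsdres`, run/shared/lean/b2b/bsd-rank1-residual/, verbatim in every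
file): the goal of the cell is to DELETE the COMBINATION-SHAPED residual classes of the
Birch–Swinnerton-Dyer formula for ALL analytic-rank `≤ 1` elliptic curves over `ℚ` — "full BSD
formula for every rank `≤ 1` curve in class `C`" assembled STRICTLY from published theorems — so
that the rank-`≤ 1` remainder becomes exactly the CONSTRUCTION-SHAPED classes, which are TYPED
(missing-input `Prop`s), NOT attempted. This is not "finishing BSD". Seat `b2b-bsdres-additive-p3`
(X8 prover B / X7 joint; typer-designate for the cell conjecture C-16 = hyp C120.1 by hyp R-16 (e)).
This file books nothing and moves no mark; X7 / X8 stay CONSTRUCTION-SHAPED; C-16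
(`Ordinary/Conjectures/KuriharaExactOrderRankOneAt3.lean`) stays an OPEN CONJECTURE — its per-level
predicate `KuriharaExactOrderAt` is the CONCLUSION of an implication whose hypothesis is not asserted.

## What this file does

The reciprocity skeleton (`Ordinary/DepthLawReciprocitySkeleton.lean` §5) derives C-16's clause at `(ℓ, k)`
from abstract data in `ℤ/3^n`: exponents `ord xl = min(n, a+v)`, `ord yl = min(n, v)`, `ord yp = min(n, m)`, two
perfect pairings, reciprocity, `a = m + F`, and the Kim-3.13-shaped reading. `Ordinary/LocalClassOrders.lean`
proves the three exponent hypotheses for the IMAGES OF THE ACTUAL POINTS under ANY identifications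
`φ_ℓ : Ẽ(𝔽_ℓ) ↠ ℤ/3^n` (kernel `3^n·Ẽ(𝔽_ℓ)`) and `φ₃ : E(ℚ₃) ↠ ℤ/3^n` (kernel `3^n·E(ℚ₃)`). This file
composes the two ON C-16's LETTER: at a good non-anomalous `3` (`a₃ ∉ {1, −2}`) with `m₃(P) = 0`
(`¬ O5.PointLocallyThreeDivisibleAt W 3 P` — so `m = 0`, `a = FLOOR = F`, the class of `P` GENERATES `E(ℚ₃)/3^n`
by `Ordinary/LocalPointsModPrimePower.lean`), and a CYCLIC Kolyvagin prime `ℓ` (`IsCyclicKolyvaginLevel W 3 ℓ`, the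
letter's clause), **`KuriharaExactOrderAt W f ℓ k P F` follows from ONE hypothesis schema — the COHOMOLOGICAL
CORE**: for every surjective family of discrete logarithms `ψ` there are a depth `n ≥ k` with `ℓ ∈ 𝒫_n`
(`Kato.IsKolyvaginPrime W 3 n ℓ`, i.e. `n ≤ k′_ℓ`; it gives `ℓ ≠ 3`, `ℓ` good and `n ≤ e_ℓ` inside the proof),
identifications `φ_ℓ`, `φ₃`, perfect pairings `Bl`, `Bp` on `ℤ/3^n`, a unit `u` (`3 ∤ u`) and an element
`xp ∈ ℤ/3^n` with
  `Bl (φ_ℓ((3^F·u)·P̄)) (φ_ℓ P̄) + Bp xp (φ₃ P) = 0`  and  `ord₃(δ̃_ℓ mod 3^k) = min(k, ord xp)`.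
Read against `R1-DEPTH-LAW.md` §2: `φ_ℓ((3^F·u)·P̄)` is the singular part of `κ_ℓ` at `ℓ` (Kato's class
`κ₁ = 3^{FLOOR}·u·P`, Mazur–Rubin 5.2.12 with `m₃ = 0`, transported by the Kolyvagin-system axiom and the
finite-singular isomorphism — absorbed into the choice of `φ_ℓ` on the singular side), `φ_ℓ P̄` and `φ₃ P` are the
classes paired against, `Bl` / `Bp` are the local Tate pairings, the sum is global reciprocity for `κ_ℓ ∪ P`,
`xp = loc^s_3 κ_ℓ` and the last equation is Kim 2022 Thm. 3.13 + (5.3) with `t = 0`. Everything else in the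
statement is a clause of C-16's letter. Nothing is asserted; the schema is precisely what is not in the tree.

References: `R1-DEPTH-LAW.md` §2; B. Mazur, K. Rubin, Mem. AMS 799 (2004), Thm. 5.2.12 [MazurRubin2004];
C.-H. Kim, Amer. J. Math. 148 (2026) = arXiv:2203.12159, Thm. 3.13, (5.3) [Kim2022StructureSelmer];
J. H. Silverman, AEC (2009), VII.2.1, IV.6.4 (through the siblings) [SilvermanAEC2009]; hyp §120.
-/

noncomputable section

open scoped Classical MatrixGroups ModularForm

open CongruenceSubgroup WeierstrassCurve Literature.NumberTheory.EllipticCurves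
  Literature.NumberTheory.EllipticCurves.ModularForms
  Literature.NumberTheory.EllipticCurves.Rank1Residual

namespace Summit.BirchSwinnertonDyer.Rank1Residual.Ordinary

section Letter

variable (W : WeierstrassCurve ℚ) [W.IsElliptic] [W.IsGloballyMinimal] {N : ℕ} (f : CuspForm (Gamma0 N) 2)
  (ℓ : ℕ) [Fact ℓ.Prime] (k : ℕ) (P : W.toAffine.Point) (F : ℕ)

/-- On C-16's letter at `3` (`3` good, `a₃ ∉ {1, −2}`, `m₃(P) = 0`) the image of `P` in `E(ℚ₃)` has the
divisibility profile of exponent `0`: **`(∃ Q, 3^j·Q = c·P) ⟺ 3^j ∣ c`** for every `j` and `c ∈ ℕ` — the class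
of `P` generates `E(ℚ₃)/3^j` (sibling `generates_mod_pow_three_of_not_pointLocallyThreeDivisibleAt`).
[cite: SilvermanAEC2009, IV.6.4 (b) and VII.2.1] -/
theorem exists_pow_smul_eq_nsmul_map_iff_of_not_pointLocallyThreeDivisibleAt
    (hgood : W.HasGoodReductionAtPrime 3) (ha1 : W.frobeniusTrace 3 ≠ 1) (ha2 : W.frobeniusTrace 3 ≠ -2)
    (hm0 : ¬ O5.PointLocallyThreeDivisibleAt W 3 P) (j : ℕ) (c : ℕ) :
    (∃ Q : (W.baseChange ℚ_[3]).toAffine.Point,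
        3 ^ j • Q = c • Affine.Point.map (W' := W.toAffine) (Algebra.ofId ℚ ℚ_[3]) P) ↔ 3 ^ j ∣ c := by
  obtain ⟨_, huniq⟩ := generates_mod_pow_three_of_not_pointLocallyThreeDivisibleAt W hgood ha1 ha2 hm0 j
  constructor
  · rintro ⟨Q, hQ⟩
    have h := huniq (c : ℤ) Q (by rw [natCast_zsmul]; exact hQ.symm)
    exact_mod_cast h
  · rintro ⟨d, rfl⟩
    exact ⟨d • Affine.Point.map (W' := W.toAffine) (Algebra.ofId ℚ ℚ_[3]) P, by rw [smul_smul]⟩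

/-- Hence, under ANY surjective additive `φ₃ : E(ℚ₃) → ℤ/3^n` with kernel `3^n·E(ℚ₃)`, the class of `P` is a
GENERATOR: **`ord₃ (φ₃ P) = 0`** — the skeleton's hypothesis `hyp` with `m = 0`, from the letter's `m₃(P) = 0`
clause. [cite: SilvermanAEC2009, IV.6.4 (b) and VII.2.1] -/
theorem zmodPowOrd_map_point_eq_zero_of_not_pointLocallyThreeDivisibleAt
    (hgood : W.HasGoodReductionAtPrime 3) (ha1 : W.frobeniusTrace 3 ≠ 1) (ha2 : W.frobeniusTrace 3 ≠ -2)
    (hm0 : ¬ O5.PointLocallyThreeDivisibleAt W 3 P) {n : ℕ}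
    (φp : (W.baseChange ℚ_[3]).toAffine.Point →+ ZMod (3 ^ n)) (hφp : Function.Surjective φp)
    (hkerp : ∀ g, φp g = 0 ↔ ∃ h, 3 ^ n • h = g) :
    zmodPowOrd 3 n (φp (Affine.Point.map (W' := W.toAffine) (Algebra.ofId ℚ ℚ_[3]) P)) = min n 0 :=
  zmodPowOrd_map_eq Nat.prime_three φp hφp hkerp fun j _ c => by
    rw [Nat.sub_zero]
    exact exists_pow_smul_eq_nsmul_map_iff_of_not_pointLocallyThreeDivisibleAt W P hgood ha1 ha2 hm0 j c

/-- **C-16's clause at `(ℓ, k)` ON ITS LETTER, from the COHOMOLOGICAL CORE as one hypothesis schema.**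
Letter clauses (verbatim binders of `KuriharaExactOrderRankOneAtThree`): `3` good with `a₃ ∉ {1, −2}` and
`m₃(P) = 0` (`¬ O5.PointLocallyThreeDivisibleAt W 3 P`); `ℓ` a CYCLIC Kolyvagin prime
(`IsCyclicKolyvaginLevel W 3 ℓ`). Hypothesis schema (per surjective `ψ` at level `3^k`): a depth `n ≥ k` with
`ℓ ∈ 𝒫_n` (`Kato.IsKolyvaginPrime W 3 n ℓ`: `ℓ ∤ 3N`, `3^n ∣ ℓ − 1`, `3^n ∣ #Ẽ(𝔽_ℓ)` — the letter's `k′_ℓ`);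
identifications `φ_ℓ : Ẽ(𝔽_ℓ) ↠ ℤ/3^n` (kernel `3^n·Ẽ(𝔽_ℓ)`) and `φ₃ : E(ℚ₃) ↠ ℤ/3^n` (kernel `3^n·E(ℚ₃)`);
perfect pairings `Bl`, `Bp`; `u` with `3 ∤ u`; `xp ∈ ℤ/3^n`; RECIPROCITY
`Bl (φ_ℓ((3^F·u)·P̄)) (φ_ℓ P̄) + Bp xp (φ₃ P) = 0`; and the Kim-3.13-shaped reading
`ord₃(δ̃_ℓ mod 3^k) = min(k, ord₃ xp)`. Conclusion: `KuriharaExactOrderAt W f ℓ k P F`, i.e.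
`ord₃(δ̃_ℓ mod 3^k) = min(k, F + 2·v_ℓ(P))` for every such `ψ`. Proof: `ℓ ∈ 𝒫_n` gives `ℓ ≠ 3`, `ℓ` good
(`dvd_conductorNorm_iff_not_hasGoodReductionAtPrime`) and `n ≤ e_ℓ`; the cyclic-level clause read on the residue
field (`natCard_torsion_residue_eq_natCard_torsion_zmod`); `LocalClassOrders` gives
`ord φ_ℓ((3^F·u)·P̄) = min(n, F + v_ℓ(P))`, `ord φ_ℓ P̄ = min(n, v_ℓ(P))`, and `ord φ₃ P = 0` from `m₃(P) = 0`;
the skeleton's derived regime (`m = 0`, `a = F`) gives `min(k, ord xp) = min(k, F + 2·v_ℓ(P))`. Nothing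
asserted: the schema is exactly R1-DEPTH-LAW §2's inputs (i)–(iv) on the letter (Kato's `κ₁ = 3^F·u·P` —
Mazur–Rubin 5.2.12 with `m₃ = 0` — transported to `ℓ`, local duality at `ℓ` and `3`, reciprocity for `Br ℚ`,
Kim Thm. 3.13 at `p = 3`), none of which is in the tree; C-16 stays OPEN.
[cite: MazurRubin2004, Thm. 5.2.12; Kim2022StructureSelmer, Thm. 3.13 and (5.3)] -/
theorem kuriharaExactOrderAt_of_letter_reciprocity
    (hgood : W.HasGoodReductionAtPrime 3) (ha1 : W.frobeniusTrace 3 ≠ 1) (ha2 : W.frobeniusTrace 3 ≠ -2)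
    (hm0 : ¬ O5.PointLocallyThreeDivisibleAt W 3 P) (hcycℓ : IsCyclicKolyvaginLevel W 3 ℓ)
    (h : ∀ ψ : (q : ℕ) → (ZMod q)ˣ →* Multiplicative (ZMod (3 ^ k)),
      (∀ q ∈ ℓ.primeFactors, Function.Surjective (ψ q)) →
        ∃ (n : ℕ) (_ : k ≤ n) (_ : Kato.IsKolyvaginPrime W 3 n ℓ)
          (φl : (((integralModelInt W).map (Int.castRingHom ℤ_[ℓ])).map
            (IsLocalRing.residue ℤ_[ℓ])).toAffine.Point →+ ZMod (3 ^ n))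
          (φp : (W.baseChange ℚ_[3]).toAffine.Point →+ ZMod (3 ^ n))
          (Bl Bp : ZMod (3 ^ n) →+ ZMod (3 ^ n) →+ ZMod (3 ^ n)) (xp : ZMod (3 ^ n)) (u : ℕ),
          Function.Surjective φl ∧ (∀ g, φl g = 0 ↔ ∃ h, 3 ^ n • h = g) ∧
          Function.Surjective φp ∧ (∀ g, φp g = 0 ↔ ∃ h, 3 ^ n • h = g) ∧
          IsUnit (Bl 1 1) ∧ IsUnit (Bp 1 1) ∧ ¬ 3 ∣ u ∧
          Bl (φl ((3 ^ F * u) • reducePoint ((integralModelInt W).map (Int.castRingHom ℤ_[ℓ]))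
                (Affine.Point.congrEquiv (W.padicModel_baseChange ℓ).symm
                  (Affine.Point.map (W' := W.toAffine) (Algebra.ofId ℚ ℚ_[ℓ]) P))))
             (φl (reducePoint ((integralModelInt W).map (Int.castRingHom ℤ_[ℓ]))
                (Affine.Point.congrEquiv (W.padicModel_baseChange ℓ).symm
                  (Affine.Point.map (W' := W.toAffine) (Algebra.ofId ℚ ℚ_[ℓ]) P)))) +
            Bp xp (φp (Affine.Point.map (W' := W.toAffine) (Algebra.ofId ℚ ℚ_[3]) P)) = 0 ∧
          (haveI : NeZero ℓ := ⟨(Fact.out : ℓ.Prime).ne_zero⟩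
           zmodPowOrd 3 k (kuriharaNumber f (3 ^ k) ℓ ψ) = min k (zmodPowOrd 3 n xp))) :
    KuriharaExactOrderAt W f ℓ k P F := by
  haveI : NeZero ℓ := ⟨(Fact.out : ℓ.Prime).ne_zero⟩
  haveI : Fact (Nat.Prime 3) := ⟨Nat.prime_three⟩
  -- the cyclic-level clause read on the residue field of `ℤ_ℓ`
  have hcyc : Nat.card {c : (((integralModelInt W).map (Int.castRingHom ℤ_[ℓ])).map
      (IsLocalRing.residue ℤ_[ℓ])).toAffine.Point // 3 • c = 0} ≤ 3 := by
    rw [natCard_torsion_residue_eq_natCard_torsion_zmod W ℓ 3]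
    exact hcycℓ.2 ℓ dvd_rfl
  intro ψ hψ
  obtain ⟨n, hk, hKP, φl, φp, Bl, Bp, xp, u, hφl, hkerl, hφp, hkerp, hBl, hBp, hu, hrec, hkim⟩ := h ψ hψ
  -- `ℓ ∈ 𝒫_n`: `ℓ ≠ 3`, `ℓ` good, `n ≤ e_ℓ`
  have hℓ3 : ℓ ≠ 3 := hKP.ne
  have hgoodℓ' : W.HasGoodReductionAtPrime ℓ := by
    by_contra hbad
    exact hKP.not_dvd_conductorNorm ((W.dvd_conductorNorm_iff_not_hasGoodReductionAtPrime ℓ).mpr hbad)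
  have hgoodℓ : ¬ (ℓ : ℤ) ∣ minimalDiscriminantInt W :=
    not_dvd_minimalDiscriminantInt_of_hasGoodReductionAtPrime' W ℓ hgoodℓ'
  have hn : n ≤ padicValNat 3 (W.reductionPointCount ℓ) :=
    (padicValNat_dvd_iff_le (reductionPointCount_ne_zero W ℓ)).mp hKP.pow_dvd_reductionPointCount
  have hxl := zmodPowOrd_map_pow_mul_smul_reduction_eq W 3 ℓ hgoodℓ hℓ3 hcyc hn φl hφl hkerl P F hu
  have hyl := zmodPowOrd_map_reduction_eq W 3 ℓ hgoodℓ hℓ3 hcyc hn φl hφl hkerl P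
  have hyp := zmodPowOrd_map_point_eq_zero_of_not_pointLocallyThreeDivisibleAt W P hgood ha1 ha2 hm0
    φp hφp hkerp
  rw [hkim]
  exact min_singularOrder_eq_of_derived Nat.prime_three Bl Bp hBl hBp hxl hyl hyp hrec
    (zero_add F).symm (Or.inl rfl) hk

end Letter

/-! ### The closed sentence: C-16 from the cohomological core quantified over its letter -/

section Closed

/-- **C-16 (closed sentence `KuriharaExactOrderRankOneAtThree`) FOLLOWS from the COHOMOLOGICAL CORE quantified
over C-16's own letter.** The hypothesis `hcore` receives every binder of the closed sentence VERBATIM (curve,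
analytic rank one, generator `P`, no rational `3`-torsion, `ρ̄₃` onto, `3` good non-anomalous, `m₃(P) = 0`,
`#Ш_an = q` with `v₃ q = s`, the modular parametrization datum with its Manin / period clauses, the cyclic
Kolyvagin prime `ℓ` at depth `k ≥ 1`) and must return, for every surjective `ψ`, the per-level schema of
`kuriharaExactOrderAt_of_letter_reciprocity` with `F = s + v₃ ∏ c_q` (FLOOR in instrument form). So the
typed conjecture is reduced to ONE explicitly spelled missing input — the Galois-cohomological layer of
R1-DEPTH-LAW §2 on the letter — with every other step kernel-checked. Nothing asserted; C-16 and the core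
both stay OPEN (the core's inputs are printed for `p ≥ 5` only: Kato, Mazur–Rubin 5.2.12, Kim Thm. 3.13).
[cite: MazurRubin2004, Thm. 5.2.12; Kim2022StructureSelmer, Thm. 3.13 and (5.3)] -/
theorem kuriharaExactOrderRankOneAtThree_of_letter_reciprocity
    (hcore : ∀ (W : WeierstrassCurve ℚ) [W.IsElliptic] [W.IsGloballyMinimal],
      W.analyticRank = 1 →
      ∀ (P : W.toAffine.Point), ¬ IsOfFinAddOrder P →
        (∀ Q : W.toAffine.Point, ∃ n : ℤ, IsOfFinAddOrder (Q - n • P)) →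
      (∀ T : W.toAffine.Point, 3 • T = 0 → T = 0) →
      W.HasSurjectiveModNGaloisRep 3 →
      W.HasGoodReductionAtPrime 3 → W.frobeniusTrace 3 ≠ 1 → W.frobeniusTrace 3 ≠ -2 →
      ¬ O5.PointLocallyThreeDivisibleAt W 3 P →
      ∀ (q : ℚ) (s : ℕ), shaAn W = (q : ℂ) → padicValRat 3 q = s →
      ∀ {N : ℕ} [NeZero N] (D : ModularParametrizationData W N),
        ¬ (3 : ℤ) ∣ D.maninConstant →
        (∃ u : ℚ, ‖(u : ℚ_[3])‖ = 1 ∧ W.realPeriodRat = u * plusPeriod D.f) →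
      ∀ (ℓ k : ℕ) [Fact ℓ.Prime], 1 ≤ k → Kato.IsKolyvaginPrime W 3 k ℓ →
        IsCyclicKolyvaginLevel W 3 ℓ →
        ∀ ψ : (q : ℕ) → (ZMod q)ˣ →* Multiplicative (ZMod (3 ^ k)),
          (∀ q ∈ ℓ.primeFactors, Function.Surjective (ψ q)) →
            ∃ (n : ℕ) (_ : k ≤ n) (_ : Kato.IsKolyvaginPrime W 3 n ℓ)
              (φl : (((integralModelInt W).map (Int.castRingHom ℤ_[ℓ])).map
                (IsLocalRing.residue ℤ_[ℓ])).toAffine.Point →+ ZMod (3 ^ n))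
              (φp : (W.baseChange ℚ_[3]).toAffine.Point →+ ZMod (3 ^ n))
              (Bl Bp : ZMod (3 ^ n) →+ ZMod (3 ^ n) →+ ZMod (3 ^ n)) (xp : ZMod (3 ^ n)) (u : ℕ),
              Function.Surjective φl ∧ (∀ g, φl g = 0 ↔ ∃ h, 3 ^ n • h = g) ∧
              Function.Surjective φp ∧ (∀ g, φp g = 0 ↔ ∃ h, 3 ^ n • h = g) ∧
              IsUnit (Bl 1 1) ∧ IsUnit (Bp 1 1) ∧ ¬ 3 ∣ u ∧
              Bl (φl ((3 ^ (s + padicValNat 3 W.tamagawaProduct) * u) •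
                    reducePoint ((integralModelInt W).map (Int.castRingHom ℤ_[ℓ]))
                      (Affine.Point.congrEquiv (W.padicModel_baseChange ℓ).symm
                        (Affine.Point.map (W' := W.toAffine) (Algebra.ofId ℚ ℚ_[ℓ]) P))))
                 (φl (reducePoint ((integralModelInt W).map (Int.castRingHom ℤ_[ℓ]))
                    (Affine.Point.congrEquiv (W.padicModel_baseChange ℓ).symm
                      (Affine.Point.map (W' := W.toAffine) (Algebra.ofId ℚ ℚ_[ℓ]) P)))) +
                Bp xp (φp (Affine.Point.map (W' := W.toAffine) (Algebra.ofId ℚ ℚ_[3]) P)) = 0 ∧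
              (haveI : NeZero ℓ := ⟨(Fact.out : ℓ.Prime).ne_zero⟩
               zmodPowOrd 3 k (kuriharaNumber D.f (3 ^ k) ℓ ψ) = min k (zmodPowOrd 3 n xp))) :
    KuriharaExactOrderRankOneAtThree := by
  intro W _ _ hr P hP hgen htors hsurj hgood ha1 ha2 hm0 q s hq hs N _ D hManin hper ℓ k _ hk hKP hcyc
  exact kuriharaExactOrderAt_of_letter_reciprocity W D.f ℓ k P _ hgood ha1 ha2 hm0 hcyc
    (hcore W hr P hP hgen htors hsurj hgood ha1 ha2 hm0 q s hq hs D hManin hper ℓ k hk hKP hcyc)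

end Closed

end Summit.BirchSwinnertonDyer.Rank1Residual.Ordinary

end
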